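/- Copyright: the b2b-balaban cell (near-miss cell 7), T⁴-continuum fan-out; row NE7b CRUX team (2), seat
t4-ne7b-formalise-leaf-03 (gen 27) — custodian's build of the OWNER's D-50-1 «THE DECORATED RECORD» (W-ne7bp1-g50-1 (a)(d2),
journal l.33902), part 1 of 2: the record.  Released under the licence of the surrounding project. -/
import Summits.QuantumFields.BalabanUV.T4Continuum.Support.HistoryRealiseCellsRunAssemblyWTVSDataLW
import Summits.QuantumFields.BalabanUV.T4Continuum.Support.HistoryRealiseCellsRunSupplyFibreWTVS

/-!
# THE (α) ASSEMBLY UNDER THE PREFIX WITH (ρ) READ OFF THE INDEX, part 1: THE BUNDLED INPUTS `HistReadDataLWD` (D-50-1)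
(re-open object (α) of row NE7b; lineage `t4-ne7b-formalise-leaf-03` gen 27, custodian of the S12-W crew)

Summits-side support leaf of the T⁴-continuum cell (rung (B)+1 on a FINITE torus only; NOT infinite volume, NOT the
mass gap, NOT the Clay statement; NOT a proof of the spine estimate NE7b — the cell's OWN estimate, NOT PRINTED, NOT
PROVED).  [folklore] ONE `structure` (a hypothesis SHAPE: data + located displays + C-side letters, NOTHING of Bałaban's
asserted); no `[cite:]` tag, no `Prop` fact minted, zero `sorry`.  Append-only: `HistReadDataLW` (p289955) and its assembly
`HistoryRealiseCellsRunAssemblyWTVSLW` (p290621) stay, UNCHANGED BY NAME.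

WHY (R-OWNER-49-1 (c)∕(e), W-ne7bp1-g50-1 (d2)).  `HistReadDataLW` displays (ρ) `FibreMass` as ONE volume-type inequality
NOT-IN-PRINT — `hρ : ∑ τ ∈ fibre kmem T K k, dmassOf ℛ Φf t τ ≤ W K * MULTOf (sharpT (φB K) (φR K)) k` for every bad key class.
IR-49-1's reading-side module `HistoryRealiseCellsRunSupplyFibreWTVS` (p293500) states INSTEAD the reading's fibre
decoration `IndexDecor` — (ρ0) no dead indices [B16 pp. 378–379], (ρ1) an injective slice + per-member decoration of every
key fibre [p. 378 (1.71)], (ρ2) the curly ∕ tree-decay envelope with slice sum `≤ W K` [pp. 388–390], (ρ3) decoration sets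
counted by the member's genealogy within the booked shares (the share check «FIBRE-1») [p. 383] — and DERIVES `hρ` from it
through the owner's M5-5 `fibreMass_of_decoration` (`hρ_of_indexDecor`).  This twin carries the decoration in place of `hρ`.

WHAT.  **`structure HistReadDataLWD`** = `HistReadDataLW` (p289955) FIELD FOR FIELD with EXACTLY ONE change: the field
`hρ` is REPLACED by **`decor : IndexDecor ℛ Φf l₀ K₀ W φB φR (cellA n F.L ℛ) (physA n F.L hn _ ℛ) jhalf Dc Sl`**; the
decoration-value and slice types `Dc Sl : Type` are two new record PARAMETERS (after the threshold letters).  Part 2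
(`HistoryRealiseCellsRunAssemblyWTVSLWD`) embeds it into `HistReadDataLW` (`toLW`, `hρ := hρ_of_indexDecor ℛ Φf decor`) and
re-homes the terminal theorem.

HONEST SCOPE.  A bundling of HYPOTHESES; by name the R-list of (α) trades ONE volume-type inequality NOT-IN-PRINT (`hρ`) for
the decoration's located displays: (ρ0) R, (ρ1) R (index reading; its key-side READING is leaf-02's IR-49-1 E-side modules
`HistoryBankingFibreDecorKeys` ∕ `…Weighted` ∕ `…Slice`, which INSTANTIATE `Dec`∕`Csl`∕`slice`), (ρ2) T∕PARAMETRIC, (ρ3)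
KERNEL modulo «FIBRE-1» (balaban-calc G38).  Nothing of Bałaban's discharged.  NE7b NOT proved; spine 0∕9.  HONEST DEPENDENCY
(cell): continuum YM on T⁴ ⇐ BetaPertH ∧ nine spine estimates (0/9 proved); BetaPertH ⇐ (D1) ∧ (D4) ∧ CAP+tail; G-an2-4
gates asym, D1 and NE2/3/4.  This file changes none of it.
-/

open Finset MeasureTheory
open Literature.MathematicalPhysics.QuantumFieldTheory.Balaban1983to89
open T4PersistenceDictionary T4PersistentHistoryCount T4BankedInduction T4PrintedShapeBanking
open T4WeightBudget T4GlobalDenominator T4LiveClassFibration T4LiveStructureGas T4LiveGasToTerms T4RecordPriceSeam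
open T4PartnerMultiplicity T4IndicatorShell T4MatchingAssembly T4MatchingClosure T4MatchingClosureSocket T4Continuum
open T4StabilitySocket T4BranchingRecordsGas T4TaggedShapeBanking T4CanonicalMenus T4RenewalChains
open Summit.QuantumFields.BalabanUV.T4Continuum.PlacementBatch Summit.QuantumFields.BalabanUV.T4Continuum.PlacementSkeleton
open Summit.QuantumFields.BalabanUV.T4Continuum.CountThresholdUniform Summit.QuantumFields.BalabanUV.T4Continuum.CountThresholdExit
open Summit.QuantumFields.BalabanUV.T4Continuum.CountSeamJunction Summit.QuantumFields.BalabanUV.T4Continuum.LateMergers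
open Summit.QuantumFields.BalabanUV.T4Continuum.HistoryFlow Summit.QuantumFields.BalabanUV.T4Continuum.HistoryRegeneration
open Summit.QuantumFields.BalabanUV.T4Continuum.HistoryTables Summit.QuantumFields.BalabanUV.T4Continuum.HistoryAssemblyTrees
open Summit.QuantumFields.BalabanUV.T4Continuum.HistoryAssemblyTerms Summit.QuantumFields.BalabanUV.T4Continuum.HistoryAssemblyPedigree
open Summit.QuantumFields.BalabanUV.T4Continuum.HistoryConstants Summit.QuantumFields.BalabanUV.T4Continuum.HistoryGen
open Literature.MathematicalPhysics.QuantumFieldTheory.Balaban1983to89.B13ScaleTransfer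
open Summit.QuantumFields.BalabanUV.T4Continuum.ZoneSkeleton Summit.QuantumFields.BalabanUV.T4Continuum.HistorySocketTH
open Summit.QuantumFields.BalabanUV.T4Continuum.HistoryCaps Summit.QuantumFields.BalabanUV.T4Continuum.HistoryAssemblyPrice
open Summit.QuantumFields.BalabanUV.T4Continuum.HistoryBankingLE Summit.QuantumFields.BalabanUV.T4Continuum.HistoryExitLE
open Summit.QuantumFields.BalabanUV.T4Continuum.HistoryAssemblyTreesLE Summit.QuantumFields.BalabanUV.T4Continuum.HistoryAssemblyTermsLE
open Summit.QuantumFields.BalabanUV.T4Continuum.HistoryRealise Summit.QuantumFields.BalabanUV.T4Continuum.HistoryAssemblyRealiseLE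
open Summit.QuantumFields.BalabanUV.T4Continuum.HistoryAssemblyMult Summit.QuantumFields.BalabanUV.T4Continuum.HistoryAssemblyMultKey
open Summit.QuantumFields.BalabanUV.T4Continuum.HistoryAssemblyRealiseRun Summit.QuantumFields.BalabanUV.T4Continuum.HistoryAssemblyRealiseMult
open Summit.QuantumFields.BalabanUV.T4Continuum.HistoryZones Summit.QuantumFields.BalabanUV.T4Continuum.HistoryRealiseCells
open Summit.QuantumFields.BalabanUV.T4Continuum.HistoryRealiseCellsRun Summit.QuantumFields.BalabanUV.T4Continuum.HistoryAssemblyRealiseRunMult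
open Summit.QuantumFields.BalabanUV.T4Continuum.HistoryRealiseCellsRunMult Summit.QuantumFields.BalabanUV.T4Continuum.HistoryAssemblyMultInstance
open Summit.QuantumFields.BalabanUV.T4Continuum.HistoryJoinsPlacedMember Summit.QuantumFields.BalabanUV.T4Continuum.PlacementSkeleton
open Summit.QuantumFields.BalabanUV.T4Continuum.HistoryJoinsPlacedMult Summit.QuantumFields.BalabanUV.T4Continuum.HistoryRealiseDistinct
open Summit.QuantumFields.BalabanUV.T4Continuum.HistoryRegionTemplates Summit.QuantumFields.BalabanUV.T4Continuum.HistoryCaps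
open Summit.QuantumFields.BalabanUV.T4Continuum.HistoryZoneEvolve (cth)
open Literature.MathematicalPhysics.QuantumFieldTheory.Balaban1983to89.B16SProfile (DropCtl)
open Summit.QuantumFields.BalabanUV.T4Continuum.HistoryRealiseCellsRunMultEnd Summit.QuantumFields.BalabanUV.T4Continuum.HistoryRealiseCellsRunMultEndD
open Summit.QuantumFields.BalabanUV.T4Continuum.HistoryRealiseCellsRunPinnedT3b Summit.QuantumFields.BalabanUV.T4Continuum.HistoryHybridRescale
open Summit.QuantumFields.BalabanUV.T4Continuum.HistoryRealiseCellsRunApex (exists_const_schemeZ)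
open Summit.QuantumFields.BalabanUV.T4Continuum.HistoryRealisePrint Summit.QuantumFields.BalabanUV.T4Continuum.HistoryRealiseWeak
open Summit.QuantumFields.BalabanUV.T4Continuum.HistoryRealisePrintReading Summit.QuantumFields.BalabanUV.T4Continuum.HistoryRealiseWeakReading
open Summit.QuantumFields.BalabanUV.T4Continuum.HistoryRealisePrintCells Summit.QuantumFields.BalabanUV.T4Continuum.HistoryRealiseWeakCells
open Summit.QuantumFields.BalabanUV.T4Continuum.HistoryRealiseCellsRunApexT3b Summit.QuantumFields.BalabanUV.T4Continuum.HistoryRealiseCellsRunApexT3bW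

open Summit.QuantumFields.BalabanUV.T4Continuum.HistoryRealiseCellsRunApexT3bWT Summit.QuantumFields.BalabanUV.T4Continuum.HistoryRealiseCellsRunPinnedT3bWT
open Summit.QuantumFields.BalabanUV.T4Continuum.HistoryRealiseCellsRunHeadlineT3bWT
open Summit.QuantumFields.BalabanUV.T4Continuum.HistoryRealiseCellsRunApexT3bWTV Summit.QuantumFields.BalabanUV.T4Continuum.HistoryBankingVolumePlug
open Summit.QuantumFields.BalabanUV.T4Continuum.HistoryRealiseCellsRunApexT3bWTVS
open Summit.QuantumFields.BalabanUV.T4Continuum.HistoryGenealogyRealise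
open Summit.QuantumFields.BalabanUV.T4Continuum.HistoryGenealogyInstantiate
open Summit.QuantumFields.BalabanUV.T4Continuum.B16HistoryIndexedRepr
open Summit.QuantumFields.BalabanUV.T4Continuum.B16HistoryIndexedTrunc
open Summit.QuantumFields.BalabanUV.T4Continuum.HistoryBankingDiscountCharge
open Summit.QuantumFields.BalabanUV.T4Continuum.HistoryBankingCreditRead
open Summit.QuantumFields.BalabanUV.T4Continuum.HistoryBankingFibreRoom
open Summit.QuantumFields.BalabanUV.T4Continuum.HistoryPriceKeys
open Summit.QuantumFields.BalabanUV.T4Continuum.HistoryRealiseCellsRunSupplyWTVS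
open Summit.QuantumFields.BalabanUV.T4Continuum.HistoryRealiseCellsRunSupplyKeysWTVS

open Summit.QuantumFields.BalabanUV.T4Continuum.HistoryRealiseCellsRunAssemblyWTVSData
open Summit.QuantumFields.BalabanUV.T4Continuum.HistoryRealiseCellsRunAssemblyWTVSDataL
open Summit.QuantumFields.BalabanUV.T4Continuum.HistoryBankingSharpShares (sBsharp)
open Summit.QuantumFields.BalabanUV.T4Continuum.HistoryBankingRoundingUnrounded (sRunr ApFlat)
open Summit.QuantumFields.BalabanUV.T4Continuum.HistoryBankingVolumeWindow (uvol)


open Summit.QuantumFields.BalabanUV.T4Continuum.HistoryRealiseCellsRunAssemblyWTVSDataLW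
open Summit.QuantumFields.BalabanUV.T4Continuum.HistoryRealiseCellsRunSupplyFibreWTVS

namespace Summit.QuantumFields.BalabanUV.T4Continuum.HistoryRealiseCellsRunAssemblyWTVSDataLWD

noncomputable section

set_option synthInstance.maxSize 1024

/-! ## The bundled inputs under the prefix, (ρ) read off the index -/

section Data

variable {F : T4Family} {G : Type*} [GaugeGroup G] [MeasurableSpace G] [HaarData G] [RegularGaugeGroup G]

/-- **THE INPUTS OF THE (α) ASSEMBLY UNDER THE PREFIX, WITH THE FIBRE DECORATION IN PLACE OF (ρ)** (D-50-1; HYPOTHESIS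
SHAPE — data + located displays + C-side letters, NOTHING of Bałaban's asserted): `HistReadDataLW` with the volume-type
display `hρ` REPLACED by the reading's `IndexDecor` (IR-49-1). [folklore] -/
structure HistReadDataLWD (D : FiniteEpsData F G) (C : T4PrintedShapeBanking.Consts) (O : PrintedO1s) (θv : ℝ)
    (rr d n : ℕ) (hn : 0 < n) (g₀ : ℕ → ℝ) (os : List (ULoop F))
    (cΛ Lr Φ β₀ : ℝ) (p₁ η η' κ κ₂ κᵥ : ℕ) (Dc Sl : Type) {DomK : ℕ → Type}
    (I : (K : ℕ) → HIndex (DomK K)) [DecidableEq (HIndex.Idx I)] {DomK' : ℕ → Type} (I' : (K : ℕ) → HIndex (DomK' K))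
    (X : ℕ → Type) [∀ K, MeasurableSpace (X K)] (μ : (K : ℕ) → Measure (X K)) [∀ K, IsFiniteMeasure (μ K)]
    (𝒢 : (K : ℕ) → GoodClass (X K)) (Y : ℕ → Type) [∀ K, MeasurableSpace (Y K)] (νB : (K : ℕ) → Measure (Y K))
    [∀ K, IsFiniteMeasure (νB K)] (𝒢' : (K : ℕ) → GoodClass (Y K)) where
  /-- the source radius -/
  l₀ : ℝ
  /-- the volume factor of the matching remainders -/
  vol : ℝ
  /-- the source radius is positive -/
  l₀_pos : 0 < l₀
  /-- the volume factor is positive -/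
  vol_pos : 0 < vol
  /-- the threshold in the number of steps -/
  K₀ : ℕ
  /-- M1∕M2-A: run A's history-indexed operations over the skeleton, per cutoff and source value -/
  RA : (K : ℕ) → ℝ → Repr172R (𝒢 K) (I K)
  /-- M1∕M2-A: run A's dressed density on its reference space -/
  ρA : (K : ℕ) → ℝ → X K → ℝ
  /-- display ((1.72) holds): the density is the sum of the level's terms -/
  holdsA : ∀ K t V, ρA K t V = ∑ a : (I K).Adm, (RA K t).term a V
  /-- display (integrability of the elementary terms) -/
  intA : ∀ K t a, ∀ ι ∈ (I K).LIdx a, Integrable ((RA K t).eterm a ι) (μ K)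
  /-- display (H2: the dressed push-forward identity) -/
  H2A : ∀ K t, |t| ≤ l₀ → K₀ ≤ K →
    ∫ U, Real.exp (t * T4GenFunBounds.prodObs (D.scheme g₀) K os U) * D.dens K (g₀ K) 0 U ∂fieldMeasure (F.P K) 0 G =
      ∫ x, ρA K t x ∂μ K
  /-- M2-B: the reading of the history choices (regions, classes, cubes; flow, memory) -/
  ℛ : HistReading I d
  /-- (c1) the reading's blocking parameter is the family's -/
  hL : ℛ.L = F.L
  /-- (c1) the reading's exponent profile is the run's own -/
  hs : ℛ.s = runProfile F.L ℛ.R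
  /-- M2-B: the factor values and envelopes -/
  Φf : HistFactors I d
  /-- display: THE identification `HistRead` -/
  hR : HistRead ℛ Φf RA l₀ K₀
  /-- display (2.5): the reading's sizes are admissible for the running couplings -/
  isRj : ∀ K s, s ≤ K → B14.IsRj F.L rr ((D.C ⟨K, F.m, g₀ K⟩).flow.g s) (ℛ.R K s)
  /-- sizes are at least one -/
  one_le_R : ∀ K, K₀ ≤ K → ∀ t, 1 ≤ ℛ.R K t
  /-- flow (K): the blocking parameter is at least four -/
  hL4 : 4 ≤ F.L
  /-- flow (K): the run's own exponent profile is non-increasing within the run (`runProfile_succ_le`) -/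
  hprof : ∀ K, K₀ ≤ K → ∀ t, t < K → runProfile F.L ℛ.R K (t + 1) ≤ runProfile F.L ℛ.R K t
  /-- flow (K): drop control of the run's own profile (`dropCtl_runProfile`) -/
  hdrop : ∀ K, K₀ ≤ K → ∀ m, DropCtl (runProfile F.L ℛ.R K) m
  /-- pass-V input condition per term: new regions consistent -/
  hN : ∀ K, K₀ ≤ K → ∀ τ ∈ HIndex.termSet I K, (ℛ.inputOf.run K τ).NewOK
  /-- pass-V input condition per term: memory domination -/
  hRm : ∀ K, K₀ ≤ K → ∀ τ ∈ HIndex.termSet I K, ∀ t k, (ℛ.inputOf.run K τ).Rm t k ≤ (ℛ.inputOf.run K τ).R t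
  /-- pass-V input condition per term: memory domination, one-step form -/
  hRmS : ∀ K, K₀ ≤ K → ∀ τ ∈ HIndex.termSet I K, ∀ t k, (ℛ.inputOf.run K τ).Rm t (k + 1) ≤ (ℛ.inputOf.run K τ).R (t + 1)
  /-- pass-V input condition per term: non-degenerate memory -/
  hRm2 : ∀ K, K₀ ≤ K → ∀ τ ∈ HIndex.termSet I K, ∀ t, 2 ≤ (ℛ.inputOf.run K τ).Rm t 1
  /-- pass-V input condition per term: disjoint new regions -/
  hD : ∀ K, K₀ ≤ K → ∀ τ ∈ HIndex.termSet I K, (ℛ.inputOf.run K τ).NewDisjoint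
  /-- pass-V input condition per term, THE INPUT DISPLAY OF R-OWNER-47-3 ∕ 48-1: every point of every new region lies in
  the torus' period box at its level (`RegionsInBox`; implies the junction's `InBoxOK` and the witness's `BoxedBirths`) -/
  hreg : ∀ K, K₀ ≤ K → ∀ τ ∈ HIndex.termSet I K, (ℛ.inputOf.run K τ).RegionsInBox n K
  /-- constants: the window constant, the discount letters -/
  hn₁ : 13 ≤ C.n₁
  /-- constants -/
  hE₂ : 0 < C.E₂
  /-- constants — `E₃` STRICTLY positive, carried ONCE (W-ne7bp1-g49-1 (i): M5-2's `huE₃` ∕ leaf-06's `ellVol` force it;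
  `HistReadDataL.hE₃ : 0 ≤ C.E₃` is its `le_of_lt`) -/
  hE₃pos : 0 < C.E₃
  /-- M5-3∕M5-4 letters per cutoff: sharp birth exponents -/
  sB : ℕ → ℕ → ℕ → ℝ
  /-- fibre shares, births -/
  φB : ℕ → ℕ → ℕ → ℝ
  /-- fibre shares, renewals -/
  φR : ℕ → ℕ → ℝ
  /-- (2.9)∕(2.7)'s letter `β′` (the letter `β₀` is a PARAMETER of the record: the volume threshold reads it) -/
  β' : ℝ
  /-- display: the factor reading, the renewal exponent FIXED to the unrounded letter `S_h = sRunr …` (R-OWNER-47-1 (a)) -/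
  hF : ∀ K, K₀ ≤ K → FactorRead (Φf.fB K) (Φf.fR K) (sB K) (sRunr O.γ₀ O.A₁ O.M Lr O.β₀ O.d p₁ (ℛ.R K) (D.C ⟨K, F.m, g₀ K⟩).flow.g)
  /-- display (2.9) on the reading's sizes -/
  h29 : ∀ K, K₀ ≤ K → B14FlowStep.FlowIneq29 (ℛ.R K) (D.C ⟨K, F.m, g₀ K⟩).flow.g F.L β' β₀ K
  /-- the term-free curly normalisation envelope -/
  W : ℕ → ℝ
  /-- display -/
  one_le_W : ∀ K, 1 ≤ W K
  /-- the term-free envelopes' K-uniform bounds -/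
  (Wi BAi mi : ℝ)
  /-- display -/
  hWi : ∀ K, W K ≤ Wi
  /-- display -/
  hBA : ∀ K t, |t| ≤ l₀ → K₀ ≤ K → Φf.BA K t ≤ BAi
  /-- display -/
  hmi : ∀ K, (μ K).real Set.univ ≤ mi
  /-- (ρ) READ OFF THE INDEX: the fibre decoration of the reading (IR-49-1 `IndexDecor`: displays (ρ0) no dead indices,
  (ρ1) injective slice + decoration, (ρ2) curly envelope with slice sum `≤ W K`, (ρ3) decoration sets counted by the
  genealogy within the booked shares «FIBRE-1») — REPLACES the volume-type display `hρ` of `HistReadDataL(W)`, which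
  part 2 DERIVES by `hρ_of_indexDecor` -/
  decor : IndexDecor ℛ Φf l₀ K₀ W φB φR (cellA n F.L ℛ) (physA n F.L hn (lt_of_lt_of_le (by norm_num) (two_le_L F)) ℛ)
    jhalf Dc Sl
  /-- the (γ) small-field mass floor -/
  c₀ : ℝ
  /-- the site budget -/
  n₁ : ℝ
  /-- the floor is positive -/
  c₀_pos : 0 < c₀
  /-- (γ) floor, run A -/
  floor : ∀ K, K₀ ≤ K → c₀ ≤ smallFieldMass D K (g₀ K)
  /-- (γ) floor, run B -/
  floor' : ∀ K, K₀ ≤ K → c₀ ≤ smallFieldMass D (K + 1) (g₀ (K + 1))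
  /-- site budget, run A -/
  sites : ∀ K, K₀ ≤ K → ((D.C ⟨K, F.m, g₀ K⟩).numSites K : ℝ) ≤ n₁
  /-- site budget, run B -/
  sites' : ∀ K, K₀ ≤ K → ((D.C ⟨K + 1, F.m, g₀ (K + 1)⟩).numSites (K + 1) : ℝ) ≤ n₁
  /-- RUN B v0.5: run B's history-indexed operations over ITS skeleton, per cutoff and source value -/
  RB : (K : ℕ) → ℝ → Repr172R (𝒢' K) (I' K)
  /-- RUN B: run B's dressed density after `K + 1` steps on its reference space -/
  ρB : (K : ℕ) → ℝ → Y (K + 1) → ℝ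
  /-- display ((1.72) holds for run B at cutoff `K + 1`) -/
  holdsB : ∀ K t V, ρB K t V = ∑ a : (I' (K + 1)).Adm, (RB (K + 1) t).term a V
  /-- display (integrability, run B) -/
  intB : ∀ K t a, ∀ ι ∈ (I' (K + 1)).LIdx a, Integrable ((RB (K + 1) t).eterm a ι) (νB (K + 1))
  /-- display (H2, run B) -/
  H2B : ∀ K t, |t| ≤ l₀ → K₀ ≤ K →
    ∫ U, Real.exp (t * T4GenFunBounds.prodObs (D.scheme g₀) (K + 1) os U) * D.dens (K + 1) (g₀ (K + 1)) 0 U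
        ∂fieldMeasure (F.P (K + 1)) 0 G = ∫ y, ρB K t y ∂νB (K + 1)
  /-- RUN B (S, NODE O): the truncation of run B's level-`(K+1)` terms onto run A's index -/
  trunc : ℕ → HIndex.Idx I' → HIndex.Idx I
  /-- display (S): the truncation maps run B's term set into run A's -/
  htr : ∀ K, K₀ ≤ K → ∀ τ' ∈ HIndex.termSet I' (K + 1), trunc K τ' ∈ HIndex.termSet I K
  /-- RUN B: per-term dead weights -/
  dB : ℕ → ℝ → HIndex.Idx I' → ℝ
  /-- RUN B: envelope -/
  mup : ℕ → ℝ → ℝ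
  /-- RUN B: sharp ∕ share letters of run B -/
  (sB' φB' : ℕ → ℕ → ℕ → ℝ)
  /-- RUN B: share letters of run B, renewals -/
  φR' : ℕ → ℕ → ℝ
  /-- display (R «TRUNC»): run B's numerator reading per term, KEYED AT RUN A's KEYS -/
  upB : ∀ K t, |t| ≤ l₀ → K₀ ≤ K →
    ∀ k ∈ badGMems (memA n F.L ℛ) jhalf (HIndex.termSet I) (kmemA n F.L hn (lt_of_lt_of_le (by norm_num) (two_le_L F)) ℛ) K,
      ∀ τ' ∈ HIndex.termSet I' (K + 1),
        trunc K τ' ∈ fibre (kmemA n F.L hn (lt_of_lt_of_le (by norm_num) (two_le_L F)) ℛ) (HIndex.termSet I) K k →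
          Repr172R.weight νB RB t τ' ≤
            dB K t τ' * LIVEOf C K (ℛ.R K) (fun m => 2 ^ (d + 3) * Real.log (Φf.Λ K m)) (sharpT (sB' K)
              (sRunr O.γ₀ O.A₁ O.M Lr O.β₀ O.d p₁ (ℛ.R K) (D.C ⟨K, F.m, g₀ K⟩).flow.g)) k *
              mup K t
  /-- display (R «TRUNC»): run B's dead weights are nonnegative over the composite fibres -/
  deadB_nonneg : ∀ K t, |t| ≤ l₀ → K₀ ≤ K →
    ∀ k ∈ badGMems (memA n F.L ℛ) jhalf (HIndex.termSet I) (kmemA n F.L hn (lt_of_lt_of_le (by norm_num) (two_le_L F)) ℛ) K,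
      ∀ τ' ∈ HIndex.termSet I' (K + 1),
        trunc K τ' ∈ fibre (kmemA n F.L hn (lt_of_lt_of_le (by norm_num) (two_le_L F)) ℛ) (HIndex.termSet I) K k →
          0 ≤ dB K t τ'
  /-- display (ρ′) (located, VOLUME type): run B's fibre mass over the COMPOSITE fibre of a key -/
  resumB : ∀ K t, |t| ≤ l₀ → K₀ ≤ K →
    ∀ k ∈ badGMems (memA n F.L ℛ) jhalf (HIndex.termSet I) (kmemA n F.L hn (lt_of_lt_of_le (by norm_num) (two_le_L F)) ℛ) K,
      ∑ τ' ∈ (HIndex.termSet I' (K + 1)).filter (fun τ' =>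
          trunc K τ' ∈ fibre (kmemA n F.L hn (lt_of_lt_of_le (by norm_num) (two_le_L F)) ℛ) (HIndex.termSet I) K k),
        dB K t τ' ≤ MULTOf (sharpT (φB' K) (φR' K)) k
  /-- display: run B's envelope bound (at `Nup := e^{BA∞}·m∞·W∞`) -/
  mup_bd : ∀ K t, |t| ≤ l₀ → K₀ ≤ K → 0 ≤ mup K t ∧ mup K t ≤ Real.exp BAi * mi * Wi
  /-- NE7c: the two runs' shell parts -/
  (shA shB : ℕ → ℝ → HIndex.Idx I → ℝ)
  /-- NE7c's shell weight budget -/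
  Wsh : ℕ → ℝ
  /-- NE7c (S): the indicator shells' relative weight bound over this reading's terms -/
  shell : ShellWeightBound l₀ (HIndex.termSet I) (fun _ t => Repr172R.weight μ RA t) (weightB νB RB trunc) shA shB Wsh
  /-- NE7 core budget data -/
  (Cc Rr CcRec RrRec : ℕ → ℝ → HIndex.Idx I → ℝ)
  /-- NE7 core budget rates -/
  (ν u s₂ q₀ r s : ℕ → ℝ)
  /-- NE7 (S): the re-indexed per-term budget over this reading's bad classes -/
  budget : ReindexedBudget l₀ vol (HIndex.termSet I) (fun K t τ => Repr172R.weight μ RA t τ - shA K t τ)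
    (fun K t τ => weightB νB RB trunc K t τ - shB K t τ)
    (badOfClass (bstrOf Prod.fst (memA n F.L ℛ)) (HIndex.termSet I)
      (fun K _ => badClasses Prod.fst (memA n F.L ℛ) jhalf (HIndex.termSet I) K)) Cc Rr CcRec RrRec ν u s₂ q₀ r s
  /-- summable rates -/
  sum_r : Summable r
  /-- summable rates -/
  sum_u : Summable u
  /-- summable rates -/
  sum_s : Summable s
  /-- summable rates -/
  sum_s₂ : Summable s₂
  /-- C-side: print's p. 380 per-cube volume constant is nonnegative -/
  hcΛ : 0 ≤ cΛ
  /-- display (H3, M2-B): the per-cube volume factor IS `e^{cΛ·ℓ_{min t K}}` — its logarithm is leaf-06's letter `uvol` -/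
  hΛ : ∀ K t, Real.log (Φf.Λ K t) = uvol cΛ (D.C ⟨K, F.m, g₀ K⟩).flow.g K t
  /-- C-side: the volume slack is positive -/
  hθv : 0 < θv
  /-- C-side: the (2.9)∕(2.7) letter `β₀` is nonnegative -/
  hβ₀ : 0 ≤ β₀
  /-- C-side: the unrounded renewal letter's `L^r` constant is nonnegative -/
  hLr : 0 ≤ Lr
  /-- C-side: the fibre's discount multiplier is nonnegative (Φ := 1 of record, R-OWNER-48-3) -/
  hΦ : 0 ≤ Φ
  /-- C-side: the birth-floor mass letter -/
  m : ℝ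
  /-- C-side: `A₁² ≤ m` -/
  hm : O.A₁ ^ 2 ≤ m
  /-- census identity (t = d+3): `p₀ + r(d+3) + η = 2p₁` -/
  hexpR : C.p₀ + rr * (O.d + 3) + η = 2 * p₁
  /-- census identity: `r(q′+1) + r(d+3) + η′ = 2p₁` -/
  hexpR' : rr * (C.q' + 1) + rr * (O.d + 3) + η' = 2 * p₁
  /-- census identity: `r(q′+1) + κ = 2p₀` -/
  hexpB : rr * (C.q' + 1) + κ = 2 * C.p₀
  /-- census identity (volume window vs the floor): `1 + κ₂ = r·q′` -/
  hexpF : 1 + κ₂ = rr * C.q'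
  /-- census identity (volume window vs the birth credit): `1 + κᵥ = 2p₀` -/
  hexpV : 1 + κᵥ = 2 * C.p₀
  /-- exponent gaps -/
  hη : 1 ≤ η
  /-- exponent gaps -/
  hη' : 1 ≤ η'
  /-- exponent gaps -/
  hκ : 1 ≤ κ
  /-- exponent gaps -/
  hκ₂ : 1 ≤ κ₂
  /-- exponent gaps -/
  hκᵥ : 1 ≤ κᵥ
  /-- constants: `1 ≤ p₀` -/
  hp₀ : 1 ≤ C.p₀
  /-- C-side: the flat renewal amplitude is nonzero -/
  hAp : ApFlat O.γ₀ O.A₁ O.M Lr O.d ≠ 0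
  /-- signs of print's O(1)s -/
  hγ₀ : 0 < O.γ₀
  /-- signs of print's O(1)s -/
  hA₁ : O.A₁ ≠ 0
  /-- signs -/
  hA₀ : 0 < C.A₀
  /-- signs -/
  hM : 0 < O.M
  /-- census: `β₀(d+2) ≤ 1` (print's O(1) `β₀` of `PrintedO1s`) -/
  hβd : O.β₀ * ((O.d : ℝ) + 2) ≤ 1
  /-- φ-BUDGET, births, run A: the fibre's own share is at most `Φ` discount shares -/
  hφB : ∀ K j d', φB K j d' ≤ Φ * dshare C F.L (ℛ.R K) ((j, 0, d') : PEv)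
  /-- φ-BUDGET, renewals, run A -/
  hφR : ∀ K h, φR K h ≤ Φ * dshare C F.L (ℛ.R K) ((h + 1, 1, 0) : PEv)
  /-- φ-BUDGET, births, run B's letters -/
  hφB' : ∀ K j d', φB' K j d' ≤ Φ * dshare C F.L (ℛ.R K) ((j, 0, d') : PEv)
  /-- φ-BUDGET, renewals, run B's letters -/
  hφR' : ∀ K h, φR' K h ≤ Φ * dshare C F.L (ℛ.R K) ((h + 1, 1, 0) : PEv)
  /-- BIRTH LETTER FLOOR, run A: the sharp birth exponent is at least print's `sBsharp` -/
  hsB : ∀ K j d', sBsharp O m C (D.C ⟨K, F.m, g₀ K⟩).flow.g j d' ≤ sB K j d'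
  /-- BIRTH LETTER FLOOR, run B's letters -/
  hsB' : ∀ K j d', sBsharp O m C (D.C ⟨K, F.m, g₀ K⟩).flow.g j d' ≤ sB' K j d'
  /-- (2.7)'s power (NE7-rate row) -/
  p27 : ℕ
  /-- (2.7)'s power is at least one -/
  hp27 : 1 ≤ p27
  /-- display (2.7) per cutoff on the run's couplings (NE7-rate row, like `h29`) -/
  h27 : ∀ K, K₀ ≤ K → B14.FlowIneq27 (D.C ⟨K, F.m, g₀ K⟩).flow.g β' β₀ p27 K

end Data

end

end Summit.QuantumFields.BalabanUV.T4Continuum.HistoryRealiseCellsRunAssemblyWTVSDataLWD
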